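import Summits.Langlands.Langlands.Statement
import Literature.NumberTheory.GaloisRepresentations.CalegariEvenFontaineMazurTwo
import HarnessLib

/-!
# On-path lemma (F4) for the rung `ScalarSignRegularReciprocity 3` of line `ScalarSignRegularGL3`
# (crux `ReciprocityUpToIrreducibility`, item stmt-Langlands-14328; ladder generation 22)

`Langlands → ScalarSignRegularReciprocity n` for every `0 < n` (in particular the rung `n = 3` and
every higher rung): clause (B) of the summit at the GIVEN reciprocity datum `Rec` applies to every `ρ`
of the sector, because the sector's de Rham clause is stated against the PINNED Fontaine datum
`fontainePstAdicCompletion v p hv`, which is `Rec.pst p v hv` by definition (`ReciprocityData.pst`), so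
the sector hypotheses give `IsGeometricFramed Rec ρ`, and (B) returns `∃ π, π.IsLAlgebraic ∧
Corresponds Rec ι π ρ` — the family's conclusion verbatim.  (`E → family` is NOT claimed: E supplies
ONE `Rec`, the family quantifies over all.)  The family is VERBATIM the one of
`Lines/ScalarSignRegularGL3.lean`.  Sorry-free; standard axioms.
-/

noncomputable section

set_option linter.dupNamespace false

open scoped MatrixGroups Matrix NumberField Classical
open Filter IsDedekindDomain Field
open Literature.NumberTheory.Automorphic Literature.NumberTheory.GaloisRepresentations
open Literature.NumberTheory.PAdicHodge
open Summit.Langlands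

namespace Summit.Langlands.Langlands.Cruxes.ReciprocityUpToIrreducibility.ScalarSignRegularGL3.OnPath

/-! ## 1. The rung family (dial = rank `n`) -/

/-- **Residual non-degeneracy at rank `n`** — the rank-`n` reading of Calegari's hypotheses (2)–(3).
At `n = 2` VERBATIM Calegari 2011 Thm. 1.2 (2) `Sym² ρ̄|Γ_{F(ζ_p)}` absolutely irreducible and (3) for
`v ∣ p`, `ρ̄|D_v` is not a twist of `(ε̄ * ; 0 1)`; at every other rank: `ρ` has a residual representation
`ρ̄` (ACC⁺ §1) with `ρ̄|Γ_{F(ζ_p)}` absolutely irreducible (the Taylor–Wiles non-degeneracy of ACC⁺ Thm.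
6.1.1–6.1.2 / Qian 2022 Thm. 1.4, minus "enormous"/"decomposed generic", which the cells carry).
[cite: Calegari2011, Thm. 1.2] [cite: ACCGHLNSTT2023, Thm. 6.1.1] -/
def ResidualNondegenerate (F : Type) [Field F] [NumberField F] (p : ℕ) [Fact p.Prime] :
    (n : ℕ) → FramedGaloisRep F (PadicAlgCl p) n → Prop
  | 2, ρ =>
      IsAbsIrreducible
        ((Matrix.GeneralLinearGroup.symSq.comp ρ.residualRep).comp
          (modPCyclotomicCharacterZMod F p).ker.subtype) ∧
      ∀ (v : HeightOneSpectrum (𝓞 F)), ((p : ℕ) : 𝓞 F) ∈ v.asIdeal →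
        ¬ IsTwistOfExtOneBy
            (ρ.residualRep.comp (absGaloisRestrict F (v.adicCompletion F)).toMonoidHom)
            (fun g => zmodToPadicAlgClResidueField p ((modPCyclotomicCharacterZMod F p
              (absGaloisRestrict F (v.adicCompletion F) g) : (ZMod p)ˣ) : ZMod p))
  | _, ρ =>
      ∃ τ : absoluteGaloisGroup F →* GL (Fin _) (padicAlgClResidueField p),
        ρ.IsResidualRepOf (RingHom.id _) τ ∧
          IsAbsIrreducible (τ.comp (absGaloisGroupAdjoinRootsOfUnity F p).subtype)

/-- **The rung family** `ScalarSignRegularReciprocity n`: clause (B) of E, for EVERY reciprocity datum,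
on the scalar-sign regular sector of rank `n` over totally real fields (`p > 7` split completely in `F`,
`ρ` irreducible, a.e. unramified, de Rham with multiplicity-free labelled Hodge–Tate weights at every
`v ∣ p` for the pinned Fontaine datum, residually non-degenerate, `ρ(c) ∈ {1, -1}` for every complex
conjugation `c`).  Conjecturally vacuous for `n ≥ 2`; at `n = 2` it follows from Calegari's theorem
(`floor_two`). -/
def ScalarSignRegularReciprocity (n : ℕ) : Prop :=
  ∀ (F : Type) [Field F] [NumberField F], NumberField.IsTotallyReal F →
  ∀ (p : ℕ) [Fact p.Prime], 7 < p → SplitsCompletely F p →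
  ∀ (ρ : FramedGaloisRep F (PadicAlgCl p) n),
    ρ.toGaloisRep.IsIrreducible →
    (∀ᶠ v : HeightOneSpectrum (𝓞 F) in cofinite, ρ.IsUnramifiedAt v) →
    (∀ (v : HeightOneSpectrum (𝓞 F)) (hv : ((p : ℕ) : 𝓞 F) ∈ v.asIdeal),
      (fontainePstAdicCompletion v p hv).IsDeRhamFramed (ρ.toLocal v) ∧
        ∀ τ : v.adicCompletion F →+* PadicAlgCl p, Continuous τ →
          (ρ.labelledHodgeTateWeightsAt v (fontainePstAdicCompletion v p hv).algebra
            (fontainePstAdicCompletion v p hv).𝔅 τ).Nodup) →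
    ResidualNondegenerate F p n ρ →
    (∀ (φ : F →+* ℝ) (c : absoluteGaloisGroup F), IsComplexConjugation φ c → ρ c = 1 ∨ ρ c = -1) →
    ∀ (Rec : ReciprocityData F) (hcpt : isCompact_glFiniteIntegralLevel n F) (ι : PadicAlgCl p ≃+* ℂ),
      ∃ π : CuspidalAutomorphicRepData n F hcpt, π.1.IsLAlgebraic ∧ Corresponds Rec ι π.1 ρ

/-- **THE RUNG** (the filed statement): the family at `n = 3`. -/
def ScalarSignRegularGL3 : Prop := ScalarSignRegularReciprocity 3

/-- **Dial monotonicity in the summit direction**: the summit gives every rung of the family (clause (B)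
of `Langlands F` at the given `Rec`; the sector's de Rham clause is stated against the PINNED Fontaine
datum `fontainePstAdicCompletion v p hv = Rec.pst p v hv`, so the hypotheses give `IsGeometricFramed Rec ρ`).
`E → family` is NOT claimed: E provides ONE reciprocity datum per field, the family serves all of them
(it is the summit's clause (B) verbatim on the sector); the line composes `family → E` instead (§5). -/
theorem scalarSignRegularReciprocity_of_langlands (n : ℕ) (hn : 0 < n) (hL : _root_.Langlands) :
    ScalarSignRegularReciprocity n := by
  intro F _ _ _hF p _ _hp _hsplit ρ hirr hur hpst _hres _hsign Rec hcpt ι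
  have hB : GaloisToAutomorphic n Rec hcpt := ((hL F).2 Rec n hn hcpt).2
  exact hB p ι ρ hirr ⟨hur, fun v hv => (hpst v hv).1⟩

/-- **F4 on-path lemma for the rung**: `Langlands → ScalarSignRegularGL3`. -/
@[aesop safe apply]
theorem ScalarSignRegularGL3_of_Langlands (hL : _root_.Langlands) : ScalarSignRegularGL3 :=
  scalarSignRegularReciprocity_of_langlands 3 (by norm_num) hL


end Summit.Langlands.Langlands.Cruxes.ReciprocityUpToIrreducibility.ScalarSignRegularGL3.OnPath

end
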